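import Summits.AtomisticToContinuum.Crystallization.Theorems.PhononSlackCertificatesPeriodicGivenLayeredClosing2

/-!
# `PeriodicGivenLayered` (stmt-AtomisticToContinuum-11779), line `Sketch`, stub `stub_closing` — part 4

Block algebra for Part B of the density closing (lead prover-line-stmt-AtomisticToContinuum-11779-0):
for a FAULT-FREE word `s` (`s (m+1) = −s m`) and admissible heights `z`, the registry energies
`T(m) = Σ'_{m' ≠ m} Φ(z m' − z m, L m' − L m)` of the `n + 1` layers `m₁, …, m₁ + n` sum to

  `Σ_{m ∈ [m₁, m₁+n]} T(m) = 2 · F_n(Δ) + R`,  `|R| ≤ 16 C`,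

where `F_n(Δ) = Σ_{i<j≤n} Φ(Δ i + ⋯ + Δ (j−1), par(j−i))` is the alternating block energy of
`stub_convexity` in the increments `Δ l = z (m₁+l+1) − z (m₁+l)` (`clo_block_decomposition`), `C` the
decay constant of the layer sums (`|Φ(H)| ≤ C/H⁴`, `stub_layerCake`). Ingredients: fault-free words
align exactly the layers at even distance (`clo_haggAligned_faultfree_iff`), so the in-block pair
interactions are those of `F_n` (`clo_pairs_eq_two_mul_block`); the interactions of the block with the
layers outside it are a boundary-layer sum controlled by the `k⁻⁴` decay (`clo_tail_bound`).
-/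

noncomputable section

namespace Summit.AtomisticToContinuum.Crystallization.Theorems.LayeredHull

open scoped BigOperators
open Finset Filter Literature.MathematicalPhysics.StatisticalMechanics

/-! ## Sums over integer intervals -/

/-- `Σ_{m ∈ [m₁, m₁+k)} f m = Σ_{i<k} f (m₁ + i)`. [folklore] -/
theorem clo_sum_Ico_eq_sum_range (f : ℤ → ℝ) (m₁ : ℤ) (k : ℕ) :
    ∑ m ∈ Finset.Ico m₁ (m₁ + k), f m = ∑ i ∈ Finset.range k, f (m₁ + i) := by
  have himg : Finset.Ico m₁ (m₁ + k) = (Finset.range k).image fun i : ℕ => m₁ + i := by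
    ext m
    simp only [Finset.mem_Ico, Finset.mem_image, Finset.mem_range]
    constructor
    · rintro ⟨h1, h2⟩
      refine ⟨(m - m₁).toNat, ?_, ?_⟩
      · have : ((m - m₁).toNat : ℤ) = m - m₁ := Int.toNat_of_nonneg (by linarith)
        omega
      · have : ((m - m₁).toNat : ℤ) = m - m₁ := Int.toNat_of_nonneg (by linarith)
        omega
    · rintro ⟨i, hi, rfl⟩
      have hi' : (i : ℤ) < k := by exact_mod_cast hi
      constructor <;> linarith
  rw [himg, Finset.sum_image fun i _ j _ h => by exact_mod_cast (add_left_cancel h : (i : ℤ) = j)]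

/-! ## Fault-free words -/

variable {s : ℤ → ℤ}

/-- A fault-free word alternates: `s (m + k) = ± s m` according to the parity of `k`. [folklore] -/
theorem clo_faultfree_add (h : ∀ m : ℤ, s (m + 1) = -s m) (m : ℤ) (k : ℕ) :
    s (m + k) = if Even k then s m else -s m := by
  induction k with
  | zero => simp
  | succ k ih =>
    push_cast
    rw [← add_assoc, h, ih]
    by_cases hk : Even k
    · rw [if_pos hk, if_neg (Nat.even_add_one.not.2 (not_not.2 hk))]
    · rw [if_neg hk, if_pos (Nat.even_add_one.2 hk), neg_neg]

/-- Windows of a fault-free word: `0` over an even length, `s m` over an odd one. [folklore] -/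
theorem clo_haggWindow_faultfree (h : ∀ m : ℤ, s (m + 1) = -s m) (m : ℤ) (k : ℕ) :
    haggWindow s m k = if Even k then 0 else s m := by
  induction k with
  | zero => simp
  | succ k ih =>
    rw [haggWindow_succ, ih, clo_faultfree_add h m k]
    by_cases hk : Even k
    · rw [if_pos hk, if_pos hk, if_neg (Nat.even_add_one.not.2 (not_not.2 hk)), zero_add]
    · rw [if_neg hk, if_neg hk, if_pos (Nat.even_add_one.2 hk), add_neg_cancel]

/-- For a fault-free Hägg word, layers `m` and `m + k` are aligned iff `k` is even. [folklore] -/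
theorem clo_haggAligned_faultfree_iff (hs : IsHaggSeq s) (h : ∀ m : ℤ, s (m + 1) = -s m) (m : ℤ)
    (k : ℕ) : HaggAligned s m k ↔ Even k := by
  change haggWindow s m k % 3 = 0 ↔ _
  rw [clo_haggWindow_faultfree h]
  by_cases hk : Even k
  · simp [hk]
  · simp only [hk, if_false, iff_false]
    rcases hs m with h1 | h1 <;> rw [h1] <;> decide

/-- **Registry of a fault-free stacking**: a site of layer `m` sees layer `m + k` aligned iff `k` is
even, so the interaction is `Φ(H, par k)` with `par k = 0` (even) or `1` (odd). [folklore] -/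
theorem clo_layerInteraction_faultfree (hs : IsHaggSeq s) (h : ∀ m : ℤ, s (m + 1) = -s m)
    (V : ℝ → ℝ) (a H : ℝ) (m : ℤ) (k : ℕ) :
    layerInteraction V a H (haggLabel s (m + k) - haggLabel s m) 1 =
      layerInteraction V a H (if Even k then 0 else 1) 1 := by
  rw [clo_layerInteraction_label_add]
  by_cases hk : Even k
  · rw [if_pos ((clo_haggAligned_faultfree_iff hs h m k).2 hk), if_pos hk]
    unfold barlowCoupling
    simp only [Nat.cast_one]
    ring
  · rw [if_neg (fun h' => hk ((clo_haggAligned_faultfree_iff hs h m k).1 h')), if_neg hk, add_zero]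

/-! ## Pair interactions inside a block -/

/-- Symmetry of the pair interaction of two layers: `Φ(−H, −δ) = Φ(H, δ)`. [folklore] -/
theorem clo_layerInteraction_symm (V : ℝ → ℝ) (a H : ℝ) (δ : ℤ) :
    layerInteraction V a (-H) (-δ) 1 = layerInteraction V a H δ 1 := by
  rw [clo_layerInteraction_neg_height, layerInteraction_neg_offset]

/-- Heights inside a block telescope: `z (m₁ + j) − z (m₁ + i) = Σ_{l ∈ [i,j)} Δ l`,
`Δ l = z (m₁+l+1) − z (m₁+l)`. [folklore] -/
theorem clo_height_telescope (z : ℤ → ℝ) (m₁ : ℤ) {i j : ℕ} (hij : i ≤ j) :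
    z (m₁ + j) - z (m₁ + i) = ∑ l ∈ Finset.Ico i j, (z (m₁ + l + 1) - z (m₁ + l)) := by
  induction j, hij using Nat.le_induction with
  | base => simp
  | succ j hij ih =>
    rw [Finset.sum_Ico_succ_top hij, ← ih]
    push_cast
    ring

/-- **In-block pair interactions of a fault-free stacking.** Over the `n + 1` layers `m₁, …, m₁+n`,
the sum over ordered pairs of distinct layers of the pair interaction equals twice the alternating
block energy `F_n(Δ)` of `stub_convexity` in the increments `Δ l = z (m₁+l+1) − z (m₁+l)`. [folklore] -/
theorem clo_pairs_eq_two_mul_block (hs : IsHaggSeq s) (h : ∀ m : ℤ, s (m + 1) = -s m)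
    (a : ℝ) (z : ℤ → ℝ) (m₁ : ℤ) (n : ℕ) :
    ∑ i ∈ Finset.range (n + 1), ∑ j ∈ Finset.range (n + 1),
        (if m₁ + (j : ℤ) = m₁ + (i : ℤ) then (0 : ℝ) else
          layerInteraction lennardJones a (z (m₁ + j) - z (m₁ + i))
            (haggLabel s (m₁ + j) - haggLabel s (m₁ + i)) 1) =
      2 * ∑ i ∈ Finset.range n, ∑ j ∈ Finset.Ioc i n, layerInteraction lennardJones a
        (∑ l ∈ Finset.Ico i j, (z (m₁ + l + 1) - z (m₁ + l))) (if Even (j - i) then 0 else 1) 1 := by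
  -- the pair function and its symmetry
  set g : ℕ → ℕ → ℝ := fun i j => layerInteraction lennardJones a (z (m₁ + j) - z (m₁ + i))
    (haggLabel s (m₁ + j) - haggLabel s (m₁ + i)) 1 with hg
  have hsymm : ∀ i j, g j i = g i j := fun i j => by
    simp only [hg]
    rw [← clo_layerInteraction_symm, neg_sub, neg_sub]
  -- ordered pairs = (i < j) + (j < i), and the second equals the first by symmetry
  have hsplit : ∀ i ∈ Finset.range (n + 1),
      (∑ j ∈ Finset.range (n + 1), if m₁ + (j : ℤ) = m₁ + (i : ℤ) then (0 : ℝ) else g i j) =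
        (∑ j ∈ Finset.range (n + 1), if i < j then g i j else 0) +
          ∑ j ∈ Finset.range (n + 1), if j < i then g i j else 0 := by
    intro i _
    rw [← Finset.sum_add_distrib]
    refine Finset.sum_congr rfl fun j _ => ?_
    rcases lt_trichotomy i j with hij | rfl | hij
    · rw [if_neg (by omega), if_pos hij, if_neg (lt_asymm hij), add_zero]
    · simp
    · rw [if_neg (by omega), if_neg (lt_asymm hij), if_pos hij, zero_add]
  have hupper : ∀ i ∈ Finset.range (n + 1),
      (∑ j ∈ Finset.range (n + 1), if i < j then g i j else 0) = ∑ j ∈ Finset.Ioc i n, g i j := by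
    intro i _
    rw [← Finset.sum_filter]
    congr 1
    ext j
    simp only [Finset.mem_filter, Finset.mem_range, Finset.mem_Ioc]
    omega
  have hlower : (∑ i ∈ Finset.range (n + 1), ∑ j ∈ Finset.range (n + 1), if j < i then g i j else 0) =
      ∑ i ∈ Finset.range (n + 1), ∑ j ∈ Finset.range (n + 1), if i < j then g i j else 0 := by
    rw [Finset.sum_comm]
    refine Finset.sum_congr rfl fun i _ => Finset.sum_congr rfl fun j _ => ?_
    by_cases hij : i < j
    · rw [if_pos hij, if_pos hij, hsymm]
    · rw [if_neg hij, if_neg hij]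
  have hlast : (∑ i ∈ Finset.range (n + 1), ∑ j ∈ Finset.Ioc i n, g i j) =
      ∑ i ∈ Finset.range n, ∑ j ∈ Finset.Ioc i n, g i j := by
    rw [Finset.sum_range_succ, Finset.Ioc_self, Finset.sum_empty, add_zero]
  -- identify the pair interaction for `i < j`
  have hpair : ∀ i ∈ Finset.range n, ∀ j ∈ Finset.Ioc i n, g i j = layerInteraction lennardJones a
      (∑ l ∈ Finset.Ico i j, (z (m₁ + l + 1) - z (m₁ + l))) (if Even (j - i) then 0 else 1) 1 := by
    intro i _ j hj
    have hij : i < j := (Finset.mem_Ioc.1 hj).1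
    simp only [hg]
    rw [← clo_height_telescope z m₁ hij.le]
    have e : m₁ + (j : ℤ) = m₁ + (i : ℤ) + ((j - i : ℕ) : ℤ) := by
      rw [Nat.cast_sub hij.le]; ring
    rw [e, clo_layerInteraction_faultfree hs h, ← e]
  -- assemble
  calc (∑ i ∈ Finset.range (n + 1), ∑ j ∈ Finset.range (n + 1),
        (if m₁ + (j : ℤ) = m₁ + (i : ℤ) then (0 : ℝ) else g i j))
      = (∑ i ∈ Finset.range (n + 1), ∑ j ∈ Finset.range (n + 1), if i < j then g i j else 0) +
          ∑ i ∈ Finset.range (n + 1), ∑ j ∈ Finset.range (n + 1), if j < i then g i j else 0 := by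
        rw [← Finset.sum_add_distrib]; exact Finset.sum_congr rfl hsplit
    _ = 2 * ∑ i ∈ Finset.range (n + 1), ∑ j ∈ Finset.Ioc i n, g i j := by
        rw [hlower, Finset.sum_congr rfl hupper]; ring
    _ = 2 * ∑ i ∈ Finset.range n, ∑ j ∈ Finset.Ioc i n, g i j := by rw [hlast]
    _ = _ := by
        congr 1
        exact Finset.sum_congr rfl fun i hi => Finset.sum_congr rfl fun j hj => hpair i hi j hj

/-! ## The interaction of a block with the layers outside it -/

/-- One-sided fourth-power tails: `Σ_{j<J} (d + j)⁻⁴ ≤ (4/3) d⁻³` for `d ≥ 1` (compare `(d+j)⁻⁴` with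
`((d+j−1)⁻³ − (d+j)⁻³)/3 · 4`, i.e. telescope `x⁻⁴ ≤ (4/3)((x−1)⁻³ − x⁻³)`… here the cruder
`x⁻⁴ ≤ (x−1)⁻³ − x⁻³ + …` is replaced by the elementary `x⁻⁴ ≤ (1/3)((x−1)⁻³ − x⁻³)` for `x ≥ 2`
plus the first term). [folklore] -/
theorem clo_sum_inv_pow_four_le (d : ℕ) (hd : 1 ≤ d) (J : ℕ) :
    ∑ j ∈ Finset.range J, ((d : ℝ) + j)⁻¹ ^ 4 ≤ 4 / 3 * ((d : ℝ))⁻¹ ^ 3 := by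
  have hd' : (1 : ℝ) ≤ d := by exact_mod_cast hd
  -- telescoping bound `x⁻⁴ ≤ (1/3)((x-1)⁻³ - x⁻³)` is false near `x = 1`; use instead
  -- `x⁻⁴ ≤ (x - 1/2)⁻³/3 - (x + 1/2)⁻³/3`? We use the simple integral-free bound
  -- `(d+j)⁻⁴ ≤ (d+j-1/2)⁻¹ (d+j)⁻¹ ((d+j-1/2)⁻¹ ... ` — simplest: `x⁻⁴ ≤ (1/3)((x-1)⁻³ - x⁻³)` for x ≥ 2
  -- and treat j = 0 separately.
  have key : ∀ x : ℝ, 2 ≤ x → x⁻¹ ^ 4 ≤ 1 / 3 * ((x - 1)⁻¹ ^ 3 - x⁻¹ ^ 3) := by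
    intro x hx
    have hx0 : 0 < x := by linarith
    have hx1 : 0 < x - 1 := by linarith
    rw [inv_pow, inv_pow, inv_pow, div_mul_eq_mul_div, one_mul]
    rw [le_div_iff₀ (by norm_num : (0 : ℝ) < 3)]
    rw [inv_eq_one_div, inv_eq_one_div, inv_eq_one_div, div_sub_div _ _ (by positivity) (by positivity),
      le_div_iff₀ (by positivity)]
    have e1 : 1 / x ^ 4 * 3 * ((x - 1) ^ 3 * x ^ 3) = 3 * (x - 1) ^ 3 / x := by
      field_simp
    rw [e1, div_le_iff₀ hx0]
    nlinarith [mul_pos hx1 hx1, mul_pos hx0 hx1]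
  induction J with
  | zero => simp only [Finset.range_zero, Finset.sum_empty]; positivity
  | succ J ih =>
    rcases J with _ | J
    · simp only [zero_add, Finset.range_one, Finset.sum_singleton, Nat.cast_zero, add_zero]
      have : ((d : ℝ))⁻¹ ^ 4 ≤ ((d : ℝ))⁻¹ ^ 3 := by
        apply pow_le_pow_of_le_one (by positivity) (inv_le_one_of_one_le₀ hd')
        norm_num
      have h3 : 0 ≤ ((d : ℝ))⁻¹ ^ 3 := by positivity
      linarith
    · -- general step: bound the whole sum by `d⁻⁴ + (1/3)(d⁻³ - (d+J+1)⁻³)`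
      have hstrong : ∀ J : ℕ, ∑ j ∈ Finset.range (J + 1), ((d : ℝ) + j)⁻¹ ^ 4 ≤
          ((d : ℝ))⁻¹ ^ 4 + 1 / 3 * (((d : ℝ))⁻¹ ^ 3 - ((d : ℝ) + (J + 1 : ℕ) - 1)⁻¹ ^ 3) := by
        intro J
        induction J with
        | zero => simp
        | succ J ihJ =>
          rw [Finset.sum_range_succ]
          have hk := key ((d : ℝ) + (J + 1 : ℕ)) (by push_cast; linarith)
          push_cast at hk ihJ ⊢
          rw [show ((d : ℝ) + ((J : ℝ) + 1 + 1) - 1) = (d : ℝ) + ((J : ℝ) + 1) by ring]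
          linarith [hk, ihJ]
      have h1 := hstrong (J + 1)
      have hpos : 0 ≤ ((d : ℝ) + ((J + 1 + 1 : ℕ) : ℝ) - 1)⁻¹ ^ 3 := by
        apply pow_nonneg; apply inv_nonneg.2; push_cast; linarith
      have : ((d : ℝ))⁻¹ ^ 4 ≤ ((d : ℝ))⁻¹ ^ 3 := by
        apply pow_le_pow_of_le_one (by positivity) (inv_le_one_of_one_le₀ hd')
        norm_num
      linarith

end Summit.AtomisticToContinuum.Crystallization.Theorems.LayeredHull

end
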